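import Summits.QuantumFields.YangMills.Theorems.BalabanUVNodesN16WilsonLoopsGaugeOrbit
import Summits.QuantumFields.YangMills.Theorems.BalabanUVNodesN16Eq42FirstMomentGauge
import Summits.QuantumFields.YangMills.Theorems.BalabanUVNodesN18BoxStokesGrowth
import HarnessLib

/-!
# YM-DAG node N16 (NE3), the located averaging pin (42) ↔ (0.4) — part 24: PLAQUETTE LASSOS GENERATE — the based closed Wilson loops of ANY configuration on `ℤᵈ`
# are products of based plaquette lassos (non-abelian lattice Stokes in GENERATOR form), so ONE `c` conjugating the based plaquette lassos of `B` into those of `A`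
# conjugates every based closed loop and gives `B = A^{κ}`; part 19's ∕ part 14's (defect) criterion REDUCED TO PLAQUETTE LASSOS + POLYAKOV WORDS

Cell `pub-ymgap`, width seat `pub-ymgap-dag-n16-w3` (director-ym №197 ∕ HUMAN RULING D-0149), generation 8; part 24 of the W1b lineage (part 19 p627023
`…N16WilsonLoopsGaugeOrbit`: `eq_gaugeAct_of_hol_conj`, `exists_unitary_periodic_gauge_iff_hol_conj`, `defect_iff_hol_conj`; part 8 p606616 `hiPart_add_e`∕`loPart_add_e`).
`--kind proof --supports stmt-QuantumFields-27366 --as helper` (K3⁸; count-neutral; 0 `def`).  `bears_on: R4∕N16`.  g7's «Not done: Lasso∕Stokes reduction of the loop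
criterion to plaquettes + Polyakov lines».

THE POINT.  Part 19 read part 14's (defect) clause off ALL based torus-closed Wilson loops of the two averages; part 18's trace test and v6's numerics look at ONE coarse
plaquette at a time.  This file closes the gap between the two: on `ℤᵈ`, for any group `G` and any configurations `A, B`,
 * §1 THE LADDER RECURSION AS A FACTORISATION OF BASED LASSOS: b07's `hol_ladder_cons` (`V(ladder (l :: Q)) = (g·V(ladder Q)·g⁻¹)·V(∂p_l)`) says the based
   ladder lasso `q ++ ladder (l :: Q) μ ++ q⁻¹` has the holonomy of (the based ladder lasso with path `q ++ [l]`, rungs `Q`) · (the based plaquette lasso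
   `q ++ lplaqWord l μ ++ q⁻¹`) (`hol_ladderLasso_cons`); hence ★ `ladderLasso_conj_of_plaqLasso_conj`: ONE `c` conjugating every based plaquette lasso of `B` into
   that of `A` conjugates every based ladder lasso (induction on the rungs).
 * §2 PART 19's BOND LOOP IS A LADDER LASSO: `Γ_{x₀,x} ∪ ⟨x, x+e_μ⟩ ∪ (−Γ_{x₀,x+e_μ})` has the holonomy of the based ladder lasso with path `Γ(hiPart_μ v) ++ seg μ v_μ`
   and rungs `Γ(loPart_μ v)`, `v = x − x₀` (`hol_bondLoop_eq_hol_ladderLasso`; `B7Prop9General.treeWord_split` and b07's `hol_seg_succ` — both signs of `v_μ` at once).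
 * §3 ★★★ `eq_gaugeAct_of_plaqLasso_conj`: conjugate based plaquette lassos ⇒ `B = A^{κ}` with part 19's DISPLAYED `κ(x) = P_B(x)⁻¹·c·P_A(x)` (part 19's reconstruction
   uses bond loops only — `eq_gaugeAct_of_bondLoop_conj`); ★★ `hol_closed_conj_of_plaqLasso_conj` (GENERATION): then EVERY based closed word is `c`-conjugate
   (`κ(x₀) = c`); `hol_closed_conj_iff_plaqLasso_conj`.
 * §4 (`G = U(N)`, periodic data) ★★ `exists_unitary_periodic_gauge_iff_plaqLasso_conj` and ★★ `defect_iff_plaqLasso_conj`: part 19's characterisations with the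
   closed-loop clause CUT DOWN to based plaquette lassos (the Polyakov clause unchanged) — part 14's (defect) clause for two schemes holds on `C` iff for every
   `U ∈ C` one unitary `c_U` conjugates the based plaquette lassos and the based Polyakov-type words of `avgIterS s₂ k U` into those of `avgIterS s₁ k U`.
HONEST FRAMING.  [folklore] word combinatorics BY NAME over b07 (`ladder`, `hol_ladder_cons`, `lplaqWord`, `hol_seg_succ`, `hol_revWord'`), `B7Prop9General.treeWord_split`,
parts 8∕19, dag-n18-w3's `YMDAG.N18.BoxStokes.disp_ladder`; 0 `def`, 0 `sorry`; nothing of [Balaban1985Averaging] asserted; no minimiser; K3⁸∕K3⁷ stubs NOT touched; N16 ∕ NE3 NOT discharged; count-neutral (typed 28∕28 ·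
discharged 5∕28 — unmoved).  One finite four-torus programme at fixed `ε` — the Yang–Mills mass gap (Clay) is NOT proved by any of this; R4 closes the conditional
finite-𝕋⁴ rung `BalabanLadder.UV` only; nothing continuum ∕ ℝ⁴ ∕ OS.
-/

set_option autoImplicit false

open scoped BigOperators Matrix Matrix.Norms.L2Operator
open NormedSpace

namespace Summit.QuantumFields.YangMills.BalabanUVNodes.N16PlaquetteLassosGaugeOrbit

open Literature.MathematicalPhysics.QuantumFieldTheory.Balaban1983to89
open B7Prop1Explicit B7Prop2Explicit
open B7Prop9General (hiPart loPart treeWord_split)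
open T4AveragingDeficitWall (IsUnitaryCfg)
open T4AveragingDeficitWallBoundary (IsPeriodicCfg)
open Summit.QuantumFields.BalabanUV.T4Continuum
open NE3EnergyShapes (IsUnitarySite IsPeriodicSite)
open Summit.QuantumFields.YangMills.BalabanUVNodes.N16AveragingPin (avgIterS)
open Summit.QuantumFields.YangMills.BalabanUVNodes.N16Eq42FirstMomentGauge (hiPart_add_e loPart_add_e)
open Summit.QuantumFields.YangMills.BalabanUVNodes.N16WilsonLoopsGaugeOrbit
  (hol_bondLoop disp_bondLoop eq_gaugeAct_of_hol_conj hol_conj_of_eq_gaugeAct exists_unitary_periodic_gauge_iff_hol_conj)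
open YMDAG.N18.BoxStokes (disp_ladder)

noncomputable section

/-! ## §1 Based lassos; the ladder recursion as a factorisation; plaquette lassos conjugate ⇒ ladder lassos conjugate -/

section Lasso

variable {d : ℕ} {G : Type*} [Group G]

/-- The holonomy of a BASED LASSO `q ++ w ++ q⁻¹` with a closed loop `w` is the conjugate `V(q)·V_y(w)·V(q)⁻¹`, `y = x₀ + disp q`. [cite: Balaban1985Averaging, (9) p.18 (shape)] -/
theorem hol_basedLasso (V : Site d → Fin d → G) (x₀ : Site d) (q w : List (Letter d)) (hw : disp w = 0) :
    hol V x₀ (q ++ w ++ revWord q) = hol V x₀ q * hol V (x₀ + disp q) w * (hol V x₀ q)⁻¹ := by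
  rw [hol_append, hol_append, disp_append, hw, add_zero, hol_revWord' V (x := x₀) (x₀ + disp q) q rfl]

/-- Based lassos are closed words. [folklore] -/
theorem disp_basedLasso (q w : List (Letter d)) (hw : disp w = 0) : disp (q ++ w ++ revWord q) = 0 := by
  rw [disp_append, disp_append, hw, disp_revWord]; abel

/-- The ladder word over no rungs is the backtrack `[+e_μ, −e_μ]`: trivial holonomy. [folklore] -/
theorem hol_ladder_nil (V : Site d → Fin d → G) (y : Site d) (μ : Fin d) : hol V y (ladder [] μ) = 1 := by
  rw [hol_ladder, hol_nil, hol_nil, disp_nil, add_zero, inv_one, one_mul, mul_one, mul_inv_cancel]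

/-- **THE LADDER RECURSION AS A FACTORISATION OF BASED LASSOS** (b07's `hol_ladder_cons` conjugated by the path): the based ladder lasso with path `q` and rungs `l :: Q`
has the holonomy of (the based ladder lasso with path `q ++ [l]` and rungs `Q`) · (the based plaquette lasso `q ++ lplaqWord l μ ++ q⁻¹`). [folklore] -/
theorem hol_ladderLasso_cons (V : Site d → Fin d → G) (x₀ : Site d) (q : List (Letter d)) (l : Letter d) (Q : List (Letter d)) (μ : Fin d) :
    hol V x₀ (q ++ ladder (l :: Q) μ ++ revWord q) =
      hol V x₀ ((q ++ [l]) ++ ladder Q μ ++ revWord (q ++ [l])) * hol V x₀ (q ++ lplaqWord l μ ++ revWord q) := by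
  rw [hol_basedLasso V x₀ q _ (disp_ladder _ μ), hol_basedLasso V x₀ (q ++ [l]) _ (disp_ladder Q μ), hol_basedLasso V x₀ q _ (disp_lplaqWord l μ),
    hol_ladder_cons, hol_append, disp_append, hol_cons, hol_nil, mul_one, disp_cons, disp_nil, add_zero, ← add_assoc]
  group

/-- **★ CONJUGATE BASED PLAQUETTE LASSOS ⇒ CONJUGATE BASED LADDER LASSOS**: if one `c` conjugates every based plaquette lasso `q ++ lplaqWord l μ ++ q⁻¹` of `B` into
that of `A` (base point `x₀`), then it conjugates every based ladder lasso `q ++ ladder Q μ ++ q⁻¹` (induction on the rungs `Q`, the path growing by one letter). [folklore] -/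
theorem ladderLasso_conj_of_plaqLasso_conj (A B : Site d → Fin d → G) (x₀ : Site d) (c : G)
    (hP : ∀ (q : List (Letter d)) (l : Letter d) (μ : Fin d),
      hol B x₀ (q ++ lplaqWord l μ ++ revWord q) = c * hol A x₀ (q ++ lplaqWord l μ ++ revWord q) * c⁻¹) :
    ∀ (Q q : List (Letter d)) (μ : Fin d), hol B x₀ (q ++ ladder Q μ ++ revWord q) = c * hol A x₀ (q ++ ladder Q μ ++ revWord q) * c⁻¹
  | [], q, μ => by
    rw [hol_basedLasso B x₀ q _ (disp_ladder _ μ), hol_basedLasso A x₀ q _ (disp_ladder _ μ), hol_ladder_nil, hol_ladder_nil]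
    group
  | l :: Q, q, μ => by
    rw [hol_ladderLasso_cons B, hol_ladderLasso_cons A, ladderLasso_conj_of_plaqLasso_conj A B x₀ c hP Q (q ++ [l]) μ, hP q l μ]
    group

end Lasso

/-! ## §2 Part 19's bond loop is a based ladder lasso (holonomy level, both signs of the coordinate at once) -/

section BondLoop

variable {d : ℕ} {G : Type*} [Group G]

/-- `V` along `seg μ (n+1)` is `V` along the word `seg μ n ++ [+e_μ]` (b07's `hol_seg_succ`; for `n < 0` the two WORDS differ by a backtrack). [folklore] -/
theorem hol_seg_add_one_eq_hol_append (V : Site d → Fin d → G) (z : Site d) (μ : Fin d) (n : ℤ) :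
    hol V z (seg μ (n + 1)) = hol V z (seg μ n ++ [((μ, true) : Letter d)]) := by
  rw [hol_seg_succ, hol_append, disp_seg, hol_cons, hol_nil, mul_one, stepHol_true]

/-- The coordinate `μ` of `v + e_μ` is `v_μ + 1`. [folklore] -/
theorem add_e_apply_self (v : Site d) (μ : Fin d) : (v + e μ) μ = v μ + 1 := by
  simp [e_apply]

/-- **★ THE BOND LOOP IS A LADDER LASSO**: part 19's based bond loop `Γ_{x₀,x} ∪ ⟨x, x+e_μ⟩ ∪ (−Γ_{x₀,x+e_μ})` has the holonomy of the based ladder lasso with path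
`p = Γ(hiPart_μ v) ++ seg μ v_μ` and rungs `S = Γ(loPart_μ v)`, `v = x − x₀`: the two tree contours share the runs of the axes `> μ` and `< μ`
(`treeWord_split`, `hiPart_add_e`, `loPart_add_e`) and differ by one step in the `μ`-run (`hol_seg_succ`). [folklore] -/
theorem hol_bondLoop_eq_hol_ladderLasso (V : Site d → Fin d → G) (x₀ x : Site d) (μ : Fin d) :
    hol V x₀ (treeWord (x - x₀) ++ [((μ, true) : Letter d)] ++ revWord (treeWord (x + e μ - x₀))) =
      hol V x₀ ((treeWord (hiPart μ (x - x₀)) ++ seg μ ((x - x₀) μ)) ++ ladder (treeWord (loPart μ (x - x₀))) μ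
        ++ revWord (treeWord (hiPart μ (x - x₀)) ++ seg μ ((x - x₀) μ))) := by
  set v : Site d := x - x₀ with hv
  set P := treeWord (hiPart μ v) with hP
  set S := treeWord (loPart μ v) with hS
  set m : ℤ := v μ with hm
  have hx : x + e μ - x₀ = v + e μ := by rw [hv]; abel
  have hsplit : treeWord v = P ++ seg μ m ++ S := treeWord_split μ v
  have hsplit' : treeWord (x + e μ - x₀) = P ++ seg μ (m + 1) ++ S := by
    rw [hx, treeWord_split μ (v + e μ), hiPart_add_e, loPart_add_e, add_e_apply_self]
  -- both words are `head ++ tail` with the same head and tails of equal holonomy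
  have hL : treeWord v ++ [((μ, true) : Letter d)] ++ revWord (treeWord (x + e μ - x₀)) =
      (P ++ seg μ m ++ S ++ [((μ, true) : Letter d)] ++ revWord S) ++ revWord (P ++ seg μ (m + 1)) := by
    rw [hsplit, hsplit']; simp only [revWord_append, List.append_assoc]
  have hR : (P ++ seg μ m) ++ ladder S μ ++ revWord (P ++ seg μ m) =
      (P ++ seg μ m ++ S ++ [((μ, true) : Letter d)] ++ revWord S) ++ revWord (P ++ seg μ m ++ [((μ, true) : Letter d)]) := by
    simp only [ladder, revWord_append, revWord_cons, revWord_nil, List.nil_append, List.append_assoc, Letter.rev, Bool.not_true,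
      List.cons_append]
  have hdisp : disp (P ++ seg μ (m + 1)) = disp (P ++ seg μ m ++ [((μ, true) : Letter d)]) := by
    simp only [disp_append, disp_seg, disp_cons, disp_nil, Letter.vec_true, add_zero, add_smul, one_smul, add_assoc]
  have hhead : x₀ + disp (P ++ seg μ m ++ S ++ [((μ, true) : Letter d)] ++ revWord S) = x₀ + disp (P ++ seg μ (m + 1)) := by
    simp only [disp_append, disp_seg, disp_cons, disp_nil, disp_revWord, Letter.vec_true, add_zero, add_smul, one_smul]; abel
  have htail : hol V x₀ (P ++ seg μ (m + 1)) = hol V x₀ (P ++ seg μ m ++ [((μ, true) : Letter d)]) := by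
    rw [hol_append, hol_seg_add_one_eq_hol_append, List.append_assoc, hol_append V x₀ P (seg μ m ++ [((μ, true) : Letter d)])]
  rw [hL, hR, hol_append V x₀ (P ++ seg μ m ++ S ++ [((μ, true) : Letter d)] ++ revWord S) (revWord (P ++ seg μ (m + 1))),
    hol_append V x₀ (P ++ seg μ m ++ S ++ [((μ, true) : Letter d)] ++ revWord S) (revWord (P ++ seg μ m ++ [((μ, true) : Letter d)])),
    hol_revWord' V (x := x₀) _ (P ++ seg μ (m + 1)) hhead, hol_revWord' V (x := x₀) _ (P ++ seg μ m ++ [((μ, true) : Letter d)]) (by rw [hhead, hdisp]),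
    htail]

end BondLoop

/-! ## §3 Conjugate based plaquette lassos ⇒ the gauge orbit; plaquette lassos generate the based closed loops -/

section Reconstruction

variable {d : ℕ} {G : Type*} [Group G]

/-- **PART 19's RECONSTRUCTION WITH ITS HYPOTHESIS CUT DOWN TO BOND LOOPS**: if every based bond loop of `B` is the `c`-conjugate of that of `A`, then `B = A^{κ}` for
part 19's displayed gauge `κ(x) = P_B(x)⁻¹·c·P_A(x)` (the proof of `eq_gaugeAct_of_hol_conj` verbatim — it never used any other loop). [folklore] -/
theorem eq_gaugeAct_of_bondLoop_conj (A B : Site d → Fin d → G) (x₀ : Site d) (c : G)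
    (hb : ∀ (x : Site d) (μ : Fin d),
      hol B x₀ (treeWord (x - x₀) ++ [((μ, true) : Letter d)] ++ revWord (treeWord (x + e μ - x₀))) =
        c * hol A x₀ (treeWord (x - x₀) ++ [((μ, true) : Letter d)] ++ revWord (treeWord (x + e μ - x₀))) * c⁻¹) :
    B = gaugeAct (fun x => (axialFn B x₀ x)⁻¹ * c * axialFn A x₀ x) A := by
  funext x μ
  have hloop := hb x μ
  rw [hol_bondLoop, hol_bondLoop] at hloop
  have hB : B x μ = (axialFn B x₀ x)⁻¹ * (axialFn B x₀ x * B x μ * (axialFn B x₀ (x + e μ))⁻¹) * axialFn B x₀ (x + e μ) := by group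
  rw [hB, hloop]
  simp only [gaugeAct]
  group

/-- **★★★ CONJUGATE BASED PLAQUETTE LASSOS DETERMINE THE GAUGE ORBIT.**  If ONE `c ∈ G` conjugates every based plaquette lasso `q ++ lplaqWord l μ ++ q⁻¹` of `B` into that of
`A` (base point `x₀`; `q` any word, `l` any letter, `μ` any axis), then `B = A^{κ}` EXACTLY with part 19's displayed gauge. [folklore] -/
theorem eq_gaugeAct_of_plaqLasso_conj (A B : Site d → Fin d → G) (x₀ : Site d) (c : G)
    (hP : ∀ (q : List (Letter d)) (l : Letter d) (μ : Fin d),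
      hol B x₀ (q ++ lplaqWord l μ ++ revWord q) = c * hol A x₀ (q ++ lplaqWord l μ ++ revWord q) * c⁻¹) :
    B = gaugeAct (fun x => (axialFn B x₀ x)⁻¹ * c * axialFn A x₀ x) A := by
  refine eq_gaugeAct_of_bondLoop_conj A B x₀ c fun x μ => ?_
  rw [hol_bondLoop_eq_hol_ladderLasso B, hol_bondLoop_eq_hol_ladderLasso A]
  exact ladderLasso_conj_of_plaqLasso_conj A B x₀ c hP _ _ μ

/-- **★★ PLAQUETTE LASSOS GENERATE THE BASED CLOSED LOOPS (non-abelian lattice Stokes, generator form)**: if one `c` conjugates every based plaquette lasso of `B` into that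
of `A`, it conjugates EVERY based closed word: `B(Γ) = c·A(Γ)·c⁻¹` for all `Γ` from `x₀` with `disp Γ = 0` — through `B = A^{κ}` and `κ(x₀) = c`. [folklore] -/
theorem hol_closed_conj_of_plaqLasso_conj (A B : Site d → Fin d → G) (x₀ : Site d) (c : G)
    (hP : ∀ (q : List (Letter d)) (l : Letter d) (μ : Fin d),
      hol B x₀ (q ++ lplaqWord l μ ++ revWord q) = c * hol A x₀ (q ++ lplaqWord l μ ++ revWord q) * c⁻¹)
    (w : List (Letter d)) (hw : disp w = 0) : hol B x₀ w = c * hol A x₀ w * c⁻¹ := by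
  rw [eq_gaugeAct_of_plaqLasso_conj A B x₀ c hP, hol_conj_of_eq_gaugeAct A _ x₀ w hw]
  simp [axialFn]

/-- … and conversely based plaquette lassos are closed words: conjugate based closed loops ⟺ conjugate based plaquette lassos. [folklore] -/
theorem hol_closed_conj_iff_plaqLasso_conj (A B : Site d → Fin d → G) (x₀ : Site d) (c : G) :
    (∀ w : List (Letter d), disp w = 0 → hol B x₀ w = c * hol A x₀ w * c⁻¹) ↔
      ∀ (q : List (Letter d)) (l : Letter d) (μ : Fin d),
        hol B x₀ (q ++ lplaqWord l μ ++ revWord q) = c * hol A x₀ (q ++ lplaqWord l μ ++ revWord q) * c⁻¹ :=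
  ⟨fun h q l μ => h _ (disp_basedLasso q _ (disp_lplaqWord l μ)), hol_closed_conj_of_plaqLasso_conj A B x₀ c⟩

end Reconstruction

/-! ## §4 `G = U(N)`: part 19's characterisations with the closed-loop clause cut down to plaquette lassos -/

section Unitary

variable {d : ℕ} {n : Type*} [Fintype n] [DecidableEq n]

/-- **★★ UNITARY PERIODIC GAUGE EQUIVALENCE ⟺ CONJUGATE BASED PLAQUETTE LASSOS + POLYAKOV WORDS.**  For `U(N)`-valued `N`-periodic `A, B` on `ℤᵈ` and a base point `x₀`:
there is a unitary `N`-periodic `κ` with `B = A^{κ}` iff there is a unitary `c` conjugating every based PLAQUETTE LASSO and every based word of net displacement `N e_i` of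
`B` into that of `A` (part 19's `exists_unitary_periodic_gauge_iff_hol_conj` with §3's generation). [folklore] -/
theorem exists_unitary_periodic_gauge_iff_plaqLasso_conj {N : ℕ} {A B : Site d → Fin d → (Matrix n n ℂ)ˣ} (hA : IsUnitaryCfg A) (hAP : IsPeriodicCfg A (N : ℤ))
    (hB : IsUnitaryCfg B) (hBP : IsPeriodicCfg B (N : ℤ)) (x₀ : Site d) :
    (∃ κ : Site d → (Matrix n n ℂ)ˣ, IsUnitarySite κ ∧ IsPeriodicSite κ (N : ℤ) ∧ B = gaugeAct κ A) ↔
      ∃ c : (Matrix n n ℂ)ˣ, c ∈ unitaryUnits (Matrix n n ℂ) ∧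
        (∀ (q : List (Letter d)) (l : Letter d) (μ : Fin d),
          hol B x₀ (q ++ lplaqWord l μ ++ revWord q) = c * hol A x₀ (q ++ lplaqWord l μ ++ revWord q) * c⁻¹) ∧
        (∀ (w : List (Letter d)) (i : Fin d), disp w = (N : ℤ) • e i → hol B x₀ w = c * hol A x₀ w * c⁻¹) := by
  rw [exists_unitary_periodic_gauge_iff_hol_conj hA hAP hB hBP x₀]
  exact exists_congr fun c => and_congr_right fun _ => and_congr_left fun _ => hol_closed_conj_iff_plaqLasso_conj A B x₀ c

variable {s₁ s₂ : ℕ → (Site d → Fin d → (Matrix n n ℂ)ˣ) → (Site d → Fin d → (Matrix n n ℂ)ˣ)} {L N k : ℕ}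
  {C : Set (Site d → Fin d → (Matrix n n ℂ)ˣ)}

/-- **★★ PART 14's (defect) CLAUSE, READ OFF PLAQUETTE LASSOS AND POLYAKOV WORDS OF THE TWO AVERAGES.**  If both `k`-fold averages of every `U ∈ C` are unitary and
`N`-periodic: pointwise coarse-gauge equivalence of the two averages on `C` ⟺ for every `U ∈ C` ONE unitary `c_U` conjugates every based PLAQUETTE LASSO and every based
Polyakov-type word of `avgIterS s₂ k U` into that of `avgIterS s₁ k U` (base point `0`) — the all-loops criterion of part 19 (`defect_iff_hol_conj`) cut down to its generators;
what part 18's trace test and `W3-PIN-ANATOMY-v6`'s numerics probe one coarse plaquette at a time. [folklore] -/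
theorem defect_iff_plaqLasso_conj
    (hu₁ : ∀ U ∈ C, IsUnitaryCfg (avgIterS s₁ k U)) (hP₁ : ∀ U ∈ C, IsPeriodicCfg (avgIterS s₁ k U) (N : ℤ))
    (hu₂ : ∀ U ∈ C, IsUnitaryCfg (avgIterS s₂ k U)) (hP₂ : ∀ U ∈ C, IsPeriodicCfg (avgIterS s₂ k U) (N : ℤ)) :
    (∀ U ∈ C, ∃ κ : Site d → (Matrix n n ℂ)ˣ, IsUnitarySite κ ∧ IsPeriodicSite κ (N : ℤ) ∧ avgIterS s₂ k U = gaugeAct κ (avgIterS s₁ k U)) ↔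
      ∀ U ∈ C, ∃ c : (Matrix n n ℂ)ˣ, c ∈ unitaryUnits (Matrix n n ℂ) ∧
        (∀ (q : List (Letter d)) (l : Letter d) (μ : Fin d),
          hol (avgIterS s₂ k U) 0 (q ++ lplaqWord l μ ++ revWord q) = c * hol (avgIterS s₁ k U) 0 (q ++ lplaqWord l μ ++ revWord q) * c⁻¹) ∧
        (∀ (w : List (Letter d)) (i : Fin d), disp w = (N : ℤ) • e i →
          hol (avgIterS s₂ k U) 0 w = c * hol (avgIterS s₁ k U) 0 w * c⁻¹) :=
  forall₂_congr fun U hU => exists_unitary_periodic_gauge_iff_plaqLasso_conj (hu₁ U hU) (hP₁ U hU) (hu₂ U hU) (hP₂ U hU) 0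

end Unitary

end

end Summit.QuantumFields.YangMills.BalabanUVNodes.N16PlaquetteLassosGaugeOrbit
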